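import Mathlib
import HarnessLib.Audit
import Summits.PneNP.PneNP.Theorems.PstarMixedCoincidence

/-!
# The two-class coincidence table `x_s(x_p ⊕ x_q) ⊕ x_{s'}(x_{p'} ⊕ x_{q'})`, by REDUCTION to the two-block table (ROUND-24, O1; memo g27 §69)

FRONTIER range-avoidance ladder, rung F-N3, ROUND 24 (cell `pnp-ideate`, prover-2 memos `g26/O1-LOCALITY-g26.md` §68 and
`g27/O1-PINNING-g27.md` §69; census node `PstarLocalGateBudgetAssembly.LocalMenuCriterionBoundGateBudget`, branch (B) =
`PstarCoincidenceExact.NoCoincidenceExact`; restricted-model proof complexity — nothing here bears on `P` versus `NP`).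

Companion of `PstarMixedCoincidence` (same substitution method, see its header).  The **TWO-CLASS** fold shape is two one-block
pairs `(s, p), (s, q)` and `(s', p'), (s', q')` (e.g. `F₁ = {t₀, o₀, t₁, o₁}`): `R₁ = x_s(x_p ⊕ x_q) ⊕ x_{s'}(x_{p'} ⊕ x_{q'})`, local
readers on six variables (linear bits `S P Q S' P' Q'`, monomial bits for the fifteen pairs; `2²²` configurations — no brute force).
With the block values `u := x_p ⊕ x_q`, `u' := x_{p'} ⊕ x_{q'}` the local reader is
`L₀(s,u,s',u') ⊕ x_p·slope₁ ⊕ x_{p'}·slope₂ ⊕ x_p x_{p'}·c` and the first reader does not see `(x_p, x_{p'})` once `(u, u')` is fixed; so (`unsat_iff_twoBlock`) joint unsatisfiability is EXACTLY: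
`L₀` is a two-block coincidence (`PstarTwoBlockCoincidence`) AND both slopes vanish on the slice (`PstarMixedCoincidence.slope_vanishes_iff`)
AND `c = 0`.

* **`unsat_true_iff`** — slice value `1`: `Msq = Ms'q'`, the linear reads `S Q S' Q'` are the row/column sums of the cross matrix
  `[[Mss', Msq'], [Mqs', Mqq']]`, `p` copies `q` on both blocks (`Msp = Msq`, `Mps' = Mqs'`, `Mpq' = Mqq'`, `Ms'p' = Ms'q'`, `Msp' = Msq'`,
  `Mqp' = Mqq'`), `P = Q`, `P' = Q'`, `Mpq = Mp'q' = 0`, `Mpp' ⊕ Mpq' ⊕ Mqp' ⊕ Mqq' = 0`; target forced;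
* **`unsat_false_iff`** — slice value `0`: only the degenerate readers `0`, `R₁`;
* `not_unsat_linear` — no `∅`-menu (linear) coincidence; `gval_eq`, `coincidence_iff_of_eval` — the bridge from an instance.

This completes the kernel (B)-tables for every fold set of rank `< 6` made of at most two AND-classes / private pairs (memo g26 §67–68):
one block (`PstarPendantCoincidence`), two blocks (`PstarTwoBlockCoincidence`), mixed (`PstarMixedCoincidence`), two classes (this file).
-/

set_option linter.dupNamespace false -- `Summit.PneNP.PneNP.…`: summit = sub-problem name (D-0017 single-conjunct layout)

open Finset Literature.Computability.Complexity
open Summit.PneNP.PneNP.Theorems.PstarFibrePolys (bit bit_xor bit_and bit_injective)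
open Summit.PneNP.PneNP.Theorems.PstarGapOneAll (gval)
open Summit.PneNP.PneNP.Theorems.PstarGConstraint (bit_gval)

namespace Summit.PneNP.PneNP.Theorems.PstarTwoClassCoincidence

open PstarTwoBlockCoincidence renaming localVal → tbVal, Unsat → TBUnsat
open PstarMixedCoincidence (slope slope_vanishes_iff)

variable {n m : ℕ}

/-! ## Small `𝔽₂` facts -/

/-- `bit (!u) = bit u + 1` in `𝔽₂`. -/
private theorem bit_not (u : Bool) : bit (!u) = bit u + 1 := by
  cases u <;> decide

/-- `bit true = 1`. -/
private theorem bit_true : bit true = 1 := rfl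

/-- `bit false = 0`. -/
private theorem bit_false : bit false = 0 := rfl

/-! ## The two-class shape `x_s(x_p ⊕ x_q) ⊕ x_{s'}(x_{p'} ⊕ x_{q'})` -/

/-- The local second reader on `(x_s, x_p, x_q, x_{s'}, x_{p'}, x_{q'})`: linear bits `S P Q S' P' Q'` and monomial bits for the fifteen pairs,
in the order `sp sq pq | s'p' s'q' p'q' | ss' sp' sq' | ps' pp' pq' | qs' qp' qq'`. -/
def localVal (S P Q S' P' Q' Msp Msq Mpq Ms'p' Ms'q' Mp'q' Mss' Msp' Msq' Mps' Mpp' Mpq' Mqs' Mqp' Mqq'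
    s p q s' p' q' : Bool) : Bool :=
  xor (xor (xor (S && s) (xor (P && p) (Q && q))) (xor (S' && s') (xor (P' && p') (Q' && q'))))
    (xor (xor (xor (Msp && (s && p)) (xor (Msq && (s && q)) (Mpq && (p && q))))
        (xor (Ms'p' && (s' && p')) (xor (Ms'q' && (s' && q')) (Mp'q' && (p' && q')))))
      (xor (xor (Mss' && (s && s')) (xor (Msp' && (s && p')) (Msq' && (s && q'))))
        (xor (xor (Mps' && (p && s')) (xor (Mpp' && (p && p')) (Mpq' && (p && q'))))
          (xor (Mqs' && (q && s')) (xor (Mqp' && (q && p')) (Mqq' && (q && q')))))))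

/-- The finite unsatisfiability condition: no `(s, p, q, s', p', q')` with `s(p ⊕ q) ⊕ s'(p' ⊕ q') = β₁` and `localVal = β₂`. -/
def Unsat (β₁ β₂ S P Q S' P' Q' Msp Msq Mpq Ms'p' Ms'q' Mp'q' Mss' Msp' Msq' Mps' Mpp' Mpq' Mqs' Mqp' Mqq' : Bool) : Prop :=
  ∀ s p q s' p' q' : Bool, xor (s && xor p q) (s' && xor p' q') = β₁ →
    localVal S P Q S' P' Q' Msp Msq Mpq Ms'p' Ms'q' Mp'q' Mss' Msp' Msq' Mps' Mpp' Mpq' Mqs' Mqp' Mqq' s p q s' p' q' ≠ β₂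

section
variable (S P Q S' P' Q' Msp Msq Mpq Ms'p' Ms'q' Mp'q' Mss' Msp' Msq' Mps' Mpp' Mpq' Mqs' Mqp' Mqq' : Bool)

/-- **Substitution, `x_p = x_{p'} = 0`**: the two-block reader in `(s, u, s', u')` with linear bits `S Q S' Q'`, fold bits `Msq, Ms'q'` and
cross bits `Mss', Msq', Mqs', Mqq'`. -/
theorem localVal_ff (s u s' u' : Bool) :
    localVal S P Q S' P' Q' Msp Msq Mpq Ms'p' Ms'q' Mp'q' Mss' Msp' Msq' Mps' Mpp' Mpq' Mqs' Mqp' Mqq' s false u s' false u' =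
      tbVal S Q S' Q' Msq Ms'q' Mss' Msq' Mqs' Mqq' s u s' u' := by
  apply bit_injective
  simp only [localVal, tbVal, bit_xor, bit_and, bit_false]
  ring

/-- **Substitution, `x_p = 1`, `x_{p'} = 0`**: adds the first slope (block data `(s', u', s, u)`, coefficients
`P Q | Ms'p Ms'q | Mpq'⊕… | Msp Msq | Mpq` — precisely `slope P Q Mps' Mqs' Mpq' Mqq' Msp Msq Mpq s' u' s u`). -/
theorem localVal_tf (s u s' u' : Bool) :
    localVal S P Q S' P' Q' Msp Msq Mpq Ms'p' Ms'q' Mp'q' Mss' Msp' Msq' Mps' Mpp' Mpq' Mqs' Mqp' Mqq' s true (!u) s' false u' =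
      xor (localVal S P Q S' P' Q' Msp Msq Mpq Ms'p' Ms'q' Mp'q' Mss' Msp' Msq' Mps' Mpp' Mpq' Mqs' Mqp' Mqq' s false u s' false u')
        (slope P Q Mps' Mqs' Mpq' Mqq' Msp Msq Mpq s' u' s u) := by
  apply bit_injective
  simp only [localVal, PstarMixedCoincidence.slope, bit_xor, bit_and, bit_false, bit_true, bit_not]
  ring

/-- **Substitution, `x_p = 0`, `x_{p'} = 1`**: adds the second slope `slope P' Q' Msp' Msq' Mqp' Mqq' Ms'p' Ms'q' Mp'q' s u s' u'`. -/
theorem localVal_ft (s u s' u' : Bool) :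
    localVal S P Q S' P' Q' Msp Msq Mpq Ms'p' Ms'q' Mp'q' Mss' Msp' Msq' Mps' Mpp' Mpq' Mqs' Mqp' Mqq' s false u s' true (!u') =
      xor (localVal S P Q S' P' Q' Msp Msq Mpq Ms'p' Ms'q' Mp'q' Mss' Msp' Msq' Mps' Mpp' Mpq' Mqs' Mqp' Mqq' s false u s' false u')
        (slope P' Q' Msp' Msq' Mqp' Mqq' Ms'p' Ms'q' Mp'q' s u s' u') := by
  apply bit_injective
  simp only [localVal, PstarMixedCoincidence.slope, bit_xor, bit_and, bit_false, bit_true, bit_not]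
  ring

/-- **Substitution, `x_p = x_{p'} = 1`**: both slopes plus the constant `Mpp' ⊕ Mpq' ⊕ Mqp' ⊕ Mqq'`. -/
theorem localVal_tt (s u s' u' : Bool) :
    localVal S P Q S' P' Q' Msp Msq Mpq Ms'p' Ms'q' Mp'q' Mss' Msp' Msq' Mps' Mpp' Mpq' Mqs' Mqp' Mqq' s true (!u) s' true (!u') =
      xor (xor (localVal S P Q S' P' Q' Msp Msq Mpq Ms'p' Ms'q' Mp'q' Mss' Msp' Msq' Mps' Mpp' Mpq' Mqs' Mqp' Mqq' s false u s' false u')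
        (xor (slope P Q Mps' Mqs' Mpq' Mqq' Msp Msq Mpq s' u' s u)
        (slope P' Q' Msp' Msq' Mqp' Mqq' Ms'p' Ms'q' Mp'q' s u s' u'))) (xor (xor Mpp' Mpq') (xor Mqp' Mqq')) := by
  apply bit_injective
  simp only [localVal, PstarMixedCoincidence.slope, bit_xor, bit_and, bit_false, bit_true, bit_not]
  ring

/-- In `Bool`: a function `L ⊕ x·t₁ ⊕ x'·t₂ ⊕ x x'·c` of `(x, x')` avoids a value only if `t₁ = t₂ = c = 0`. -/
private theorem coeffs_zero {L t₁ t₂ c β : Bool} (h₀₀ : L ≠ β) (h₁₀ : xor L t₁ ≠ β) (h₀₁ : xor L t₂ ≠ β)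
    (h₁₁ : xor (xor L (xor t₁ t₂)) c ≠ β) : t₁ = false ∧ t₂ = false ∧ c = false := by
  revert h₀₀ h₁₀ h₀₁ h₁₁; cases L <;> cases t₁ <;> cases t₂ <;> cases c <;> cases β <;> decide

/-- **THE REDUCTION.**  The two-class reader is a coincidence iff its `x_p = x_{p'} = 0` part is a two-block coincidence in the block values
`(u, u') = (x_p ⊕ x_q, x_{p'} ⊕ x_{q'})`, both slopes vanish on the slice, and `Mpp' ⊕ Mpq' ⊕ Mqp' ⊕ Mqq' = 0`. -/
theorem unsat_iff_twoBlock (β₁ β₂ : Bool) :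
    Unsat β₁ β₂ S P Q S' P' Q' Msp Msq Mpq Ms'p' Ms'q' Mp'q' Mss' Msp' Msq' Mps' Mpp' Mpq' Mqs' Mqp' Mqq' ↔
      TBUnsat β₁ β₂ S Q S' Q' Msq Ms'q' Mss' Msq' Mqs' Mqq' ∧
        (∀ s' u' s u : Bool, xor (s' && u') (s && u) = β₁ → slope P Q Mps' Mqs' Mpq' Mqq' Msp Msq Mpq s' u' s u = false) ∧
        (∀ s u s' u' : Bool, xor (s && u) (s' && u') = β₁ → slope P' Q' Msp' Msq' Mqp' Mqq' Ms'p' Ms'q' Mp'q' s u s' u' = false) ∧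
        xor (xor Mpp' Mpq') (xor Mqp' Mqq') = false := by
  constructor
  · intro h
    have key : ∀ s u s' u' : Bool, xor (s && u) (s' && u') = β₁ →
        localVal S P Q S' P' Q' Msp Msq Mpq Ms'p' Ms'q' Mp'q' Mss' Msp' Msq' Mps' Mpp' Mpq' Mqs' Mqp' Mqq' s false u s' false u' ≠ β₂ ∧
          slope P Q Mps' Mqs' Mpq' Mqq' Msp Msq Mpq s' u' s u = false ∧
          slope P' Q' Msp' Msq' Mqp' Mqq' Ms'p' Ms'q' Mp'q' s u s' u' = false ∧ xor (xor Mpp' Mpq') (xor Mqp' Mqq') = false := by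
      intro s u s' u' hsl
      have h₀₀ := h s false u s' false u' (by rwa [Bool.false_xor, Bool.false_xor])
      have h₁₀ := h s true (!u) s' false u' (by rwa [Bool.true_xor, Bool.not_not, Bool.false_xor])
      have h₀₁ := h s false u s' true (!u') (by rwa [Bool.false_xor, Bool.true_xor, Bool.not_not])
      have h₁₁ := h s true (!u) s' true (!u') (by rwa [Bool.true_xor, Bool.not_not, Bool.true_xor, Bool.not_not])
      rw [localVal_tf] at h₁₀
      rw [localVal_ft] at h₀₁
      rw [localVal_tt] at h₁₁
      exact ⟨h₀₀, coeffs_zero h₀₀ h₁₀ h₀₁ h₁₁⟩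
    refine ⟨fun s u s' u' hsl => ?_, fun s' u' s u hsl => ?_, fun s u s' u' hsl => (key s u s' u' hsl).2.2.1, ?_⟩
    · rw [← localVal_ff]; exact (key s u s' u' hsl).1
    · rw [Bool.xor_comm] at hsl; exact (key s u s' u' hsl).2.1
    · -- the slice is non-empty at either value: `(s,u,s',u') = (β₁, 1, 0, 0)`
      exact (key β₁ true false false (by cases β₁ <;> rfl)).2.2.2
  · rintro ⟨h2, hs₁, hs₂, hc⟩ s p q s' p' q' hsl
    obtain ⟨u, rfl⟩ : ∃ u, q = xor p u := ⟨xor p q, by rw [← Bool.xor_assoc, Bool.xor_self, Bool.false_xor]⟩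
    obtain ⟨u', rfl⟩ : ∃ u', q' = xor p' u' := ⟨xor p' q', by rw [← Bool.xor_assoc, Bool.xor_self, Bool.false_xor]⟩
    rw [← Bool.xor_assoc, Bool.xor_self, Bool.false_xor, ← Bool.xor_assoc, Bool.xor_self, Bool.false_xor] at hsl
    have e₀ :
        localVal S P Q S' P' Q' Msp Msq Mpq Ms'p' Ms'q' Mp'q' Mss' Msp' Msq' Mps' Mpp' Mpq' Mqs' Mqp' Mqq' s false u s' false u' ≠ β₂ := by
      rw [localVal_ff]; exact h2 s u s' u' hsl
    have e₁ := hs₁ s' u' s u (by rwa [Bool.xor_comm] at hsl)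
    have e₂ := hs₂ s u s' u' hsl
    cases p <;> cases p'
    · rwa [Bool.false_xor, Bool.false_xor]
    · rw [Bool.false_xor, Bool.true_xor, localVal_ft, e₂, Bool.xor_false]; exact e₀
    · rw [Bool.true_xor, Bool.false_xor, localVal_tf, e₁, Bool.xor_false]; exact e₀
    · rw [Bool.true_xor, Bool.true_xor, localVal_tt, e₁, e₂, hc, Bool.xor_false, Bool.xor_false, Bool.xor_false]; exact e₀

/-- **Slice value `1`: the two-block rule in the block values `(u, u')`** plus `p`-copies-`q` on both blocks, `P = Q`, `P' = Q'`,
`Mpq = Mp'q' = 0`, and an even number of the four `pp'`-type cross bits (given the copies: `Mpp' = Mqq'`). -/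
theorem unsat_true_iff (β₂ : Bool) :
    Unsat true β₂ S P Q S' P' Q' Msp Msq Mpq Ms'p' Ms'q' Mp'q' Mss' Msp' Msq' Mps' Mpp' Mpq' Mqs' Mqp' Mqq' ↔
      (Msq = Ms'q' ∧ S = xor Mss' Msq' ∧ Q = xor Mqs' Mqq' ∧ S' = xor Mss' Mqs' ∧ Q' = xor Msq' Mqq' ∧ β₂ = !(xor (xor S Q) Msq)) ∧
        (P = Q ∧ Mps' = Mqs' ∧ Mpq' = Mqq' ∧ Msp = Msq ∧ Mpq = false) ∧
        (P' = Q' ∧ Msp' = Msq' ∧ Mqp' = Mqq' ∧ Ms'p' = Ms'q' ∧ Mp'q' = false) ∧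
        xor (xor Mpp' Mpq') (xor Mqp' Mqq') = false := by
  rw [unsat_iff_twoBlock, PstarTwoBlockCoincidence.unsat_true_iff, slope_vanishes_iff, slope_vanishes_iff]

/-- **Slice value `0`: only degenerate readers** (`0`, or `R₁` itself with target `1`). -/
theorem unsat_false_iff (β₂ : Bool) :
    Unsat false β₂ S P Q S' P' Q' Msp Msq Mpq Ms'p' Ms'q' Mp'q' Mss' Msp' Msq' Mps' Mpp' Mpq' Mqs' Mqp' Mqq' ↔
      (S = false ∧ Q = false ∧ S' = false ∧ Q' = false ∧ Mss' = false ∧ Msq' = false ∧ Mqs' = false ∧ Mqq' = false ∧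
          Msq = Ms'q' ∧ β₂ = true) ∧
        (P = Q ∧ Mps' = Mqs' ∧ Mpq' = Mqq' ∧ Msp = Msq ∧ Mpq = false) ∧
        (P' = Q' ∧ Msp' = Msq' ∧ Mqp' = Mqq' ∧ Ms'p' = Ms'q' ∧ Mp'q' = false) ∧
        xor (xor Mpp' Mpq') (xor Mqp' Mqq') = false := by
  rw [unsat_iff_twoBlock, PstarTwoBlockCoincidence.unsat_false_iff, slope_vanishes_iff, slope_vanishes_iff]

end

/-- In particular **no LINEAR local reader** is a coincidence on the two-class shape, either slice value. -/
theorem not_unsat_linear (β₁ β₂ S P Q S' P' Q' : Bool) (hlin : (S || P || Q || S' || P' || Q') = true) :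
    ¬ Unsat β₁ β₂ S P Q S' P' Q' false false false false false false false false false false false false false false false := by
  cases β₁
  · rw [unsat_false_iff]
    revert hlin; cases S <;> cases P <;> cases Q <;> cases S' <;> cases P' <;> cases Q' <;> simp
  · rw [unsat_true_iff]
    revert hlin; cases S <;> cases P <;> cases Q <;> cases S' <;> cases P' <;> cases Q' <;> simp

/-! ### The bridge from an instance -/
section Instance

variable (I : LocalMap 4 n m) {t o t' o' : Fin m} {s p q s' p' q' : Fin n}

/-- In `𝔽₂`: `bit (s(p ⊕ q) ⊕ s'(p' ⊕ q'))`. -/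
private theorem bit_twoClass (s p q s' p' q' : Bool) :
    bit (xor (s && xor p q) (s' && xor p' q')) = bit s * bit p + bit s * bit q + (bit s' * bit p' + bit s' * bit q') := by
  rw [bit_xor, bit_and, bit_and, bit_xor, bit_xor]; ring

/-- **The first reader**: `gval ∅ {t, o, t', o'} = x_s(x_p ⊕ x_q) ⊕ x_{s'}(x_{p'} ⊕ x_{q'})` for members with AND pairs `(s,p)`, `(s,q)`,
`(s',p')`, `(s',q')`. -/
theorem gval_eq (hto : t ≠ o) (htt' : t ≠ t') (hto' : t ≠ o') (hot' : o ≠ t') (hoo' : o ≠ o') (ht'o' : t' ≠ o')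
    (ht : I.vars t 2 = s ∧ I.vars t 3 = p) (ho : I.vars o 2 = s ∧ I.vars o 3 = q)
    (ht' : I.vars t' 2 = s' ∧ I.vars t' 3 = p') (ho' : I.vars o' 2 = s' ∧ I.vars o' 3 = q') (z : Fin n → Bool) :
    gval I ∅ {t, o, t', o'} z = xor (z s && xor (z p) (z q)) (z s' && xor (z p') (z q')) := by
  classical
  apply bit_injective
  have h1 : t ∉ ({o, t', o'} : Finset (Fin m)) := by simp [hto, htt', hto']
  have h2 : o ∉ ({t', o'} : Finset (Fin m)) := by simp [hot', hoo']
  rw [bit_gval, sum_empty, zero_add, sum_insert h1, sum_insert h2, sum_pair ht'o', ht.1, ht.2, ho.1, ho.2, ht'.1, ht'.2,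
    ho'.1, ho'.2, bit_twoClass]
  ring

/-- **THE BRIDGE.**  If the two readers evaluate as `R₁` and `localVal` on six distinct variables, joint unsatisfiability over all
assignments is exactly `Unsat`. -/
theorem coincidence_iff_of_eval (hsp : s ≠ p) (hsq : s ≠ q) (hss' : s ≠ s') (hsp' : s ≠ p') (hsq' : s ≠ q') (hpq : p ≠ q)
    (hps' : p ≠ s') (hpp' : p ≠ p') (hpq' : p ≠ q') (hqs' : q ≠ s') (hqp' : q ≠ p') (hqq' : q ≠ q') (hs'p' : s' ≠ p')
    (hs'q' : s' ≠ q') (hp'q' : p' ≠ q')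
    {R₁ R₂ : (Fin n → Bool) → Bool}
    {S P Q S' P' Q' Msp Msq Mpq Ms'p' Ms'q' Mp'q' Mss' Msp' Msq' Mps' Mpp' Mpq' Mqs' Mqp' Mqq' : Bool}
    (hR₁ : ∀ z, R₁ z = xor (z s && xor (z p) (z q)) (z s' && xor (z p') (z q')))
    (hR₂ : ∀ z, R₂ z = localVal S P Q S' P' Q' Msp Msq Mpq Ms'p' Ms'q' Mp'q' Mss' Msp' Msq' Mps' Mpp' Mpq' Mqs' Mqp' Mqq'
      (z s) (z p) (z q) (z s') (z p') (z q')) (β₁ β₂ : Bool) :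
    (∀ z : Fin n → Bool, ¬ (R₁ z = β₁ ∧ R₂ z = β₂)) ↔
      Unsat β₁ β₂ S P Q S' P' Q' Msp Msq Mpq Ms'p' Ms'q' Mp'q' Mss' Msp' Msq' Mps' Mpp' Mpq' Mqs' Mqp' Mqq' := by
  constructor
  · intro h xs xp xq xs' xp' xq' hR hval
    set z : Fin n → Bool := Function.update (Function.update (Function.update (Function.update (Function.update
      (Function.update (fun _ => false) s xs) p xp) q xq) s' xs') p' xp') q' xq' with hz
    have hzs : z s = xs := by
      rw [hz, Function.update_of_ne hsq', Function.update_of_ne hsp', Function.update_of_ne hss', Function.update_of_ne hsq,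
        Function.update_of_ne hsp, Function.update_self]
    have hzp : z p = xp := by
      rw [hz, Function.update_of_ne hpq', Function.update_of_ne hpp', Function.update_of_ne hps', Function.update_of_ne hpq,
        Function.update_self]
    have hzq : z q = xq := by
      rw [hz, Function.update_of_ne hqq', Function.update_of_ne hqp', Function.update_of_ne hqs', Function.update_self]
    have hzs' : z s' = xs' := by rw [hz, Function.update_of_ne hs'q', Function.update_of_ne hs'p', Function.update_self]
    have hzp' : z p' = xp' := by rw [hz, Function.update_of_ne hp'q', Function.update_self]
    have hzq' : z q' = xq' := by rw [hz, Function.update_self]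
    refine h z ⟨?_, ?_⟩
    · rw [hR₁, hzs, hzp, hzq, hzs', hzp', hzq']; exact hR
    · rw [hR₂, hzs, hzp, hzq, hzs', hzp', hzq']; exact hval
  · rintro h z ⟨e₁, e₂⟩
    rw [hR₁] at e₁
    rw [hR₂] at e₂
    exact h _ _ _ _ _ _ e₁ e₂

end Instance


end Summit.PneNP.PneNP.Theorems.PstarTwoClassCoincidence
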